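import Summits.Ventures.Crystal3D.StickySpheres.ThirtySixContactList
import Summits.Ventures.Crystal3D.StickySpheres.FourteenVertexConesFinal
import HarnessLib

/-!
# The T(14) list hypothesis follows from «`S_13(36)` = the eight»; `C(14) = 40` from that statement

Venture `Crystal3D` (cell `pub-crystal3d`, seat p1). `FourteenVertexCones*.lean` prove `C(14) = 40` from the `n ≥ 9` lists of
record and the six-row hypothesis `CompleteListHypothesis 4 36 13 (tableSet 13 L36d4rows)` (the minimum-degree-4 part of the
`(13, 36)` stratum). `ThirtySixContactList.lean` spells the cell's headline census statement «`S_13(36)` = the eight [HC16]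
clusters» as `CompleteListHypothesis 3 36 13 (tableSet 13 HC13rows)`. Here: the latter IMPLIES the former
(`completeList_L36d4_of_HC13`: a minimum-degree-4 graph cannot be isomorphic to g1, g2 or g3, whose table vertex `0` has
degree `3`, and g4–g8 ARE rows `2, 1, 0, 3, 5` of `L36d4rows`; the carried sixth row is not needed), hence `C(14) = 40` and
the whole table `C(4..14)` follow from the `n = 9, 10, 11, 12` lists of record together with the eight-table statement
(`maxContacts_three_fourteen_of_thirtySixList`, `contactTable_and_fourteen_of_thirtySixList`).
HONEST FRAMING: all lists are HYPOTHESES (cell census statements at the grade «E1 single-decider base lists», custody ×2);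
bookkeeping + small kernel checks, standard axioms.
-/

namespace Summit.Ventures.Crystal3D

open Finset SimpleGraph

/-- Degrees of a valid table graph are its row counts (whatever the instances). [folklore] -/
theorem degree_tableGraph_eq_rowDeg {m : ℕ} (rows : List ℕ) (hs : symmB (adjOfRows rows : Fin m → Fin m → Bool) = true)
    (hl : irreflB (adjOfRows rows : Fin m → Fin m → Bool) = true) (v : Fin m)
    [Fintype ((tableGraph m rows).neighborSet v)] :
    (tableGraph m rows).degree v = rowDeg (adjOfRows rows : Fin m → Fin m → Bool) v := by
  rw [degree_congr_of_eq (tableGraph_eq hs hl) v, degree_boolGraph']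

/-- **The six-row T(14) hypothesis follows from the eight-table statement:** if every relaxed-realisable 13-vertex graph
with `36` edges and minimum degree `≥ 3` is one of the eight [HC16] tables, then every such graph with minimum degree `≥ 4`
is one of the six rows `L36d4rows` (indeed one of g4–g8: tables g1–g3 have a vertex of degree `3`). [folklore] -/
theorem completeList_L36d4_of_HC13 (hS : CompleteListHypothesis 3 36 13 (tableSet 13 HC13rows)) :
    CompleteListHypothesis 4 36 13 (tableSet 13 L36d4rows) := by
  classical
  intro G _ he hd hG
  obtain ⟨H, ⟨k, hk, rfl⟩, ⟨φ⟩⟩ := hS G he (fun i => le_trans (by norm_num) (hd i)) hG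
  have hk8 : k < 8 := by simpa [HC13rows, HC13d3rows] using hk
  have key : ∀ v, 4 ≤ (tableGraph 13 (HC13rows.getD k [])).degree v := fun v => by
    have h1 := hd (φ.symm v)
    have h2 := φ.degree_eq (φ.symm v)
    rw [RelIso.apply_symm_apply] at h2
    rw [← h2] at h1
    convert h1
  interval_cases k
  · exact absurd (key 0) (by
      rw [degree_tableGraph_eq_rowDeg (m := 13) _ (by decide +kernel) (by decide +kernel)]; decide +kernel)
  · exact absurd (key 0) (by
      rw [degree_tableGraph_eq_rowDeg (m := 13) _ (by decide +kernel) (by decide +kernel)]; decide +kernel)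
  · exact absurd (key 0) (by
      rw [degree_tableGraph_eq_rowDeg (m := 13) _ (by decide +kernel) (by decide +kernel)]; decide +kernel)
  · exact ⟨_, ⟨2, by decide, rfl⟩, ⟨φ⟩⟩
  · exact ⟨_, ⟨1, by decide, rfl⟩, ⟨φ⟩⟩
  · exact ⟨_, ⟨0, by decide, rfl⟩, ⟨φ⟩⟩
  · exact ⟨_, ⟨3, by decide, rfl⟩, ⟨φ⟩⟩
  · exact ⟨_, ⟨5, by decide, rfl⟩, ⟨φ⟩⟩

/-- **`C(14) = 40` from the `n = 9..12` lists of record and «`S_13(36)` = the eight».** [folklore] -/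
theorem maxContacts_three_fourteen_of_thirtySixList (h21 : L21d4Complete)
    (h25 : CompleteListHypothesis 3 25 10 (tableSet 10 L25rows))
    (h24 : CompleteListHypothesis 3 24 10 (tableSet 10 L24rows))
    (h28 : CompleteListHypothesis 3 28 11 (tableSet 11 L28cRows))
    (h32 : CompleteListHypothesis 3 32 12 (tableSet 12 L32cRows))
    (hS : CompleteListHypothesis 3 36 13 (tableSet 13 HC13rows)) : maxContacts 3 14 = 40 :=
  maxContacts_three_fourteen_of_carriedLists_ge_nine h21 h25 h24 h28 h32 (completeList_L36d4_of_HC13 hS)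

/-- **The table `C(4..13) = 6, 9, 12, 15, 18, 21, 25, 29, 33, 36` and `C(14) = 40`** from the `n = 9..12` lists of record
and «`S_13(36)` = the eight». [folklore] -/
theorem contactTable_and_fourteen_of_thirtySixList (h21 : L21d4Complete)
    (h25 : CompleteListHypothesis 3 25 10 (tableSet 10 L25rows))
    (h24 : CompleteListHypothesis 3 24 10 (tableSet 10 L24rows))
    (h28 : CompleteListHypothesis 3 28 11 (tableSet 11 L28cRows))
    (h32 : CompleteListHypothesis 3 32 12 (tableSet 12 L32cRows))
    (hS : CompleteListHypothesis 3 36 13 (tableSet 13 HC13rows)) :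
    (∀ n, 4 ≤ n → n ≤ 13 → maxContacts 3 n = contactTable n) ∧ maxContacts 3 14 = 40 :=
  contactTable_and_fourteen_of_carriedLists_ge_nine h21 h25 h24 h28 h32 (completeList_L36d4_of_HC13 hS)

/-- The connected-graphs reading: the eight-table statement over CONNECTED graphs suffices (a disconnected relaxed-realisable
13-vertex graph with all degrees `≥ 3` has at most `27 < 36` edges). [folklore] -/
theorem completeList_36_13_three_of_conn (L : Set (SimpleGraph (Fin 13))) (h : CompleteListHypothesisConn 3 36 13 L) :
    CompleteListHypothesis 3 36 13 L :=
  CompleteListHypothesis.of_conn (by norm_num) (fun a h1 h2 => by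
    have h3 : a ≤ 9 := by omega
    interval_cases a <;>
      norm_num [maxContacts_three_four, maxContacts_three_five, maxContacts_three_six, maxContacts_three_seven_eq,
        maxContacts_three_eight_eq, maxContacts_three_nine_eq]) h

end Summit.Ventures.Crystal3D
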